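import Literature.NumberTheory.GaloisRepresentations.PstWeilDeligne
import Literature.NumberTheory.GaloisRepresentations.OrdinaryRegular
import HarnessLib

/-!
# Ordinary ("crystalline-ordinary") Galois representations with cyclotomic diagonal at `v ∣ ℓ`

Topic `Literature/NumberTheory/GaloisRepresentations`.

Let `F` be a non-archimedean local field (intended: `F = K_v`, `v ∣ ℓ`), `Γ_F` its absolute Galois
group, `I_F ≤ Γ_F` the inertia group (accepted `absInertia F`) and `ε = ε_ℓ : Γ_F →ₜ* ℤ_ℓˣ` the
`ℓ`-adic cyclotomic character (accepted `GaloisRep.cyclotomicCharacter F ℓ`).  A continuous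
`ρ : Γ_F →ₜ* GL_n(A)` is called here **(crystalline-)ordinary with cyclotomic exponents
`b : Fin n → ℤ`** if, after a change of frame `g ∈ GL_n(A)`, it is upper triangular
(accepted `FramedRep.IsUpperTriangular`) with diagonal entries (accepted `FramedRep.diagEntry`)
`(g ρ(σ) g⁻¹)_{ii} = ψ_i(σ) · ε(σ)^{b_i}` for unramified characters `ψ_i : Γ_F →ₜ* GL_1(A)`
(accepted `FramedRep.IsLocallyUnramified`: trivial on `I_F`); and **(crystalline-)ordinary** if this
holds for some STRICTLY DECREASING `b` (the invariant line — the first basis vector — carries the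
largest power of `ε`; the `n` exponents are pairwise distinct, "regular").  The second notion is
EXACTLY the inline clause `ORD` repeated (up to three times per item) in the statements of route
`SiegelEisensteinFern` (`Summits/Langlands/Langlands/Theses/SiegelEisensteinFern.lean`, items
`stmt-Langlands-2689…2694`): `FramedGaloisRep.isCrystallineOrdinaryAt_padicAlgCl_iff` restates it
verbatim for `A = ℚ̄_ℓ = PadicAlgCl ℓ`.

## Position in the literature and in the tree

* Greenberg's ordinary condition [Greenberg1991, §2]: a decreasing, exhaustive and separated
  filtration `F^i V` by `Γ_F`-stable subspaces with `I_F` acting on `gr^i V = F^i/F^{i+1}` through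
  `ε^i`.  `IsCrystallineOrdinary` is the special case of a FULL FLAG with one-dimensional graded
  pieces and pairwise distinct exponents (`F^i = ⟨e_j : b_j ≥ i⟩`); conversely a Greenberg-ordinary
  `V` all of whose non-zero graded pieces are lines satisfies it.
* Thorne's / Geraghty's "ordinary of weight `λ`" [Thorne2012, Def. 3.9] — in the tree as
  `FramedGaloisRep.IsOrdinaryOfLabelledWeight art ρ λ` / `IsOrdinaryRegular` (`OrdinaryRegular.lean`,
  Qian's Def. 1.2, relative to a local Artin datum `art`): rank-one graded pieces whose characters
  agree with `α ↦ ∏_τ τ(α)^{-(λ_{τ,n-i+1}+i-1)}` on an OPEN SUBGROUP of `𝒪_F^×`.  Granted the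
  class-field-theoretic identity `ε ∘ Art_F = N_{F/ℚ_ℓ}` on units (geometric normalisation; not in
  the tree, cf. the module docstring of `OrdinaryRegular.lean`), `IsCrystallineOrdinaryOfExponents b`
  with `b` strictly decreasing is "ordinary of the PARALLEL dominant weight `λ`,
  `b_i = -(λ_{n-i+1}+i-1)`, with the `ψ_i` unramified on ALL of `I_F`" (Thorne and Qian allow
  finite ramification of the `ψ_i`).  Neither implication is stated as a lemma (it needs that
  identity and an Artin datum); the present notion needs NO Artin datum, which is why the route
  could inline it.
* `FramedGaloisRep.IsPOrdinary` (`POrdinaryGaloisRep.lean`, BLGGT §1.4 in parabolic form, Artin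
  datum, open subgroup of inertia) likewise; its docstring records that the "ss-ordinary" variant
  (condition on all of inertia) was not defined there — for the Borel with parallel weights it is
  the present file.
* `FramedGaloisRep.IsOrdinaryOfWeight p ρ k m` (`OrdinaryGaloisRep.lean`, Skinner–Wiles, rank `2`,
  cyclotomic form, `ψ_i` of finite order dividing `m` on inertia): in rank `2`,
  `IsCrystallineOrdinaryOfExponents ℓ ρ ![k-1, 0]` implies `IsOrdinaryOfWeight ℓ ρ k 1`
  (`IsCrystallineOrdinaryOfExponents.isOrdinaryOfWeight`, proved).
* Emerton–Gee [EmertonGee2022, Def. 6.4.1] call a CRYSTALLINE representation of regular weight `λ`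
  ordinary when it has such a flag with crystalline diagonal characters.

## Caveat on the name (fixed by the requesting route)

The predicate does NOT imply that `ρ` is crystalline: the Tate curve over `F` gives an extension of
the trivial character by `ε` which is upper triangular with `b = (1, 0)`, `ψ = 1`, hence satisfies
the clause, and is semi-stable non-crystalline.  What is true — Perrin-Riou
[PerrinRiou1994Ordinaires]: (Greenberg-)ordinary ⇒ semi-stable, hence de Rham (Fontaine
[FontaineAsterisque223III]) — is not vendored here: the tree has no construction of `B_st`/`B_dR`
(`PstWeilDeligne.lean` works with an abstract `PstWeilDeligneData`), so
"`IsCrystallineOrdinaryAt` ⇒ `IsDeRhamFramed` for the genuine `B_dR`" is a statement for the route to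
target, not a fact this file could state faithfully about an arbitrary datum.

## Contents

* `FramedRep.IsCrystallineOrdinaryOfExponents ℓ ρ b`, `FramedRep.IsCrystallineOrdinary ℓ ρ` — the
  local predicates, for any commutative topological coefficient ring `A` with `[Algebra ℤ_[ℓ] A]`
  (the powers `ε(σ)^{b_i}`, `b_i ∈ ℤ`, are taken in the group `Aˣ` after pushing `ε(σ) ∈ ℤ_ℓˣ`
  along `algebraMap ℤ_[ℓ] A`, so no field structure on `A` is needed: `A = ℤ_ℓ, 𝒪_E, E, ℚ̄_ℓ`,
  deformation rings).
* `FramedGaloisRep.IsCrystallineOrdinaryAt ℓ v ρ := (ρ.toLocal v).IsCrystallineOrdinary ℓ` — the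
  global predicate at a finite place `v` of a number field (intended for `v ∣ ℓ`; as in the route,
  which quantifies `∀ v, ℓ ∈ v → ORD v`, the definition itself does not demand `v ∣ ℓ`).
* API (all proved): the route-shaped unfoldings `FramedRep.isCrystallineOrdinary_iff`,
  `FramedGaloisRep.isCrystallineOrdinaryAt_iff` and, over `ℚ̄_ℓ`, the verbatim clause
  `isCrystallineOrdinaryAt_padicAlgCl_iff`; invariance under change of frame
  (`…_conj_iff`); the determinant of an ordinary representation
  (`IsCrystallineOrdinaryOfExponents.exists_det_eq`); the rank-`2` comparison with Skinner–Wiles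
  (`IsCrystallineOrdinaryOfExponents.isOrdinaryOfWeight`); non-vacuity: the cyclotomic character
  itself is ordinary with `b = 1`, `ψ = 1` (`isCrystallineOrdinary_cyclotomic`).

Universe: `F K : Type` (forced by the accepted `FramedRep.IsLocallyUnramified` and by
`v.adicCompletion K`; all summit statements use `K : Type`).

## References

* R. Greenberg, *Iwasawa theory for motives*, in: L-functions and Arithmetic (Durham 1989), LMS
  Lecture Note Ser. 153 (1991), 211–234, §2. [Greenberg1991]
* J. Thorne, *On the automorphy of l-adic Galois representations with small residual image*,
  J. Inst. Math. Jussieu 11 (2012), Def. 3.9, Thm. 3.10–3.11 (p. 8 of arXiv:1107.5989); notation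
  p. 4 (`HT_τ(ε) = {-1}`, uniformisers ↦ geometric Frobenii). [Thorne2012]
* M. Emerton, T. Gee, *Moduli stacks of étale (φ, Γ)-modules and the existence of crystalline
  lifts*, Ann. of Math. Stud. 215 (2022), Def. 6.4.1. [EmertonGee2022]
* B. Perrin-Riou, *Représentations p-adiques ordinaires*, Astérisque 223 (1994), 185–220
  (Exposé IV; not held, cited for context only). [PerrinRiou1994Ordinaires]
* J.-M. Fontaine, *Représentations p-adiques semi-stables*, Astérisque 223 (1994), Exposé III.
  [FontaineAsterisque223III]
* C. Skinner, A. Wiles, *Residually reducible representations and modular forms*, Publ. Math.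
  IHÉS 89 (1999), §1. [SkinnerWiles1999]
-/

noncomputable section

open Field IsDedekindDomain
open scoped NumberField MatrixGroups

namespace Literature.NumberTheory.GaloisRepresentations

/-! ### The local predicates -/

section Local

variable {F : Type} [Field F] [ValuativeRel F] [TopologicalSpace F] [IsNonarchimedeanLocalField F]
  (ℓ : ℕ) [Fact ℓ.Prime] {A : Type*} [CommRing A] [TopologicalSpace A] [IsTopologicalRing A]
  [Algebra ℤ_[ℓ] A] {n : ℕ}

/-- **`ρ : Γ_F →ₜ* GL_n(A)` is (crystalline-)ordinary with cyclotomic exponents `b`**: there are a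
change of frame `g ∈ GL_n(A)` and unramified characters `ψ_i : Γ_F →ₜ* GL_1(A)`
(`FramedRep.IsLocallyUnramified`: trivial on the inertia group `I_F`) such that `g ρ g⁻¹` is upper
triangular (`FramedRep.IsUpperTriangular`) with diagonal entries
`(g ρ(σ) g⁻¹)_{ii} = ψ_i(σ) · ε(σ)^{b_i}` for all `σ ∈ Γ_F`, where `ε = GaloisRep.cyclotomicCharacter
F ℓ` is pushed into `Aˣ` along `algebraMap ℤ_[ℓ] A` and the integer power is taken in the group
`Aˣ`.  Equivalently `Aⁿ` has a full `Γ_F`-stable flag whose `i`-th graded line is `ψ_i ε^{b_i}`.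
Greenberg's ordinary condition (inertia acts on `gr^i` by `ε^i`) for a full flag; "ordinary of the
parallel weight with `HT = -b`" with the `ψ_i` unramified on all of `I_F` (Thorne 2012, Def. 3.9,
allows finite ramification); implies semi-stable (Perrin-Riou), NOT crystalline (Tate curve) — the
name follows the requesting route `SiegelEisensteinFern`.
[cite: Greenberg1991, §2 (definition of an ordinary p-adic representation)] -/
def FramedRep.IsCrystallineOrdinaryOfExponents (ρ : FramedRep (absoluteGaloisGroup F) A n)
    (b : Fin n → ℤ) : Prop :=
  ∃ (g : GL (Fin n) A) (ψ : Fin n → FramedRep (absoluteGaloisGroup F) A 1),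
    (∀ i, (ψ i).IsLocallyUnramified) ∧ FramedRep.IsUpperTriangular (ρ.conj g) ∧
      ∀ (σ : absoluteGaloisGroup F) (i : Fin n), FramedRep.diagEntry (ρ.conj g) i σ =
        (ψ i).trace σ *
          ((Units.map (algebraMap ℤ_[ℓ] A).toMonoidHom (GaloisRep.cyclotomicCharacter F ℓ σ) ^ b i :
            Aˣ) : A)

/-- **`ρ : Γ_F →ₜ* GL_n(A)` is (crystalline-)ordinary with distinct cyclotomic exponents**: it is
ordinary with cyclotomic exponents `b` (`IsCrystallineOrdinaryOfExponents`) for some STRICTLY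
DECREASING `b : Fin n → ℤ` (row index top → bottom: the invariant line carries the largest power of
`ε`; pairwise distinct exponents = distinct Hodge–Tate weights, "regular").  This is the inline clause
`ORD` of route `SiegelEisensteinFern` (`isCrystallineOrdinary_iff` gives its exact shape); Greenberg's
ordinary condition for a full flag with distinct exponents; implies semi-stable (Perrin-Riou), not
crystalline.
[cite: Greenberg1991, §2 (definition of an ordinary p-adic representation)] -/
def FramedRep.IsCrystallineOrdinary (ρ : FramedRep (absoluteGaloisGroup F) A n) : Prop :=
  ∃ b : Fin n → ℤ, StrictAnti b ∧ ρ.IsCrystallineOrdinaryOfExponents ℓ b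

variable {ℓ} in
/-- Ordinary with strictly decreasing exponents `b` implies ordinary. [folklore] -/
theorem FramedRep.IsCrystallineOrdinaryOfExponents.isCrystallineOrdinary
    {ρ : FramedRep (absoluteGaloisGroup F) A n} {b : Fin n → ℤ}
    (h : ρ.IsCrystallineOrdinaryOfExponents ℓ b) (hb : StrictAnti b) : ρ.IsCrystallineOrdinary ℓ :=
  ⟨b, hb, h⟩

/-- **The route's shape.** `IsCrystallineOrdinary` unfolded and regrouped exactly as the inline
clause `ORD` of route `SiegelEisensteinFern`: `∃ g b ψ, StrictAnti b ∧ (∀ i, ψ_i unramified) ∧ ∀ σ,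
(entries of g ρ(σ) g⁻¹ below the diagonal vanish) ∧ (∀ i, (g ρ(σ) g⁻¹)_{ii} = ψ_i(σ) · ε(σ)^{b_i})`.
[folklore] -/
theorem FramedRep.isCrystallineOrdinary_iff (ρ : FramedRep (absoluteGaloisGroup F) A n) :
    ρ.IsCrystallineOrdinary ℓ ↔
      ∃ (g : GL (Fin n) A) (b : Fin n → ℤ) (ψ : Fin n → FramedRep (absoluteGaloisGroup F) A 1),
        StrictAnti b ∧ (∀ i, (ψ i).IsLocallyUnramified) ∧
          ∀ σ, (∀ i₁ i₂ : Fin n, i₂ < i₁ → (ρ.conj g σ).val i₁ i₂ = 0) ∧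
            ∀ i, (ρ.conj g σ).val i i = (ψ i).trace σ *
              ((Units.map (algebraMap ℤ_[ℓ] A).toMonoidHom (GaloisRep.cyclotomicCharacter F ℓ σ) ^
                  b i : Aˣ) : A) := by
  constructor
  · rintro ⟨b, hb, g, ψ, hψ, htri, hdiag⟩
    exact ⟨g, b, ψ, hb, hψ, fun σ => ⟨fun i₁ i₂ hlt => htri σ i₁ i₂ hlt, fun i => hdiag σ i⟩⟩
  · rintro ⟨g, b, ψ, hb, hψ, h⟩
    exact ⟨b, hb, g, ψ, hψ, fun σ i₁ i₂ hlt => (h σ).1 i₁ i₂ hlt, fun σ i => (h σ).2 i⟩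

/-- **Ordinarity with exponents `b` does not see the frame**: `P ρ P⁻¹` is ordinary with exponents
`b` iff `ρ` is (frames `g P`, resp. `g P⁻¹`; `FramedRep.conj_conj`). [folklore] -/
theorem FramedRep.isCrystallineOrdinaryOfExponents_conj_iff (P : GL (Fin n) A)
    (ρ : FramedRep (absoluteGaloisGroup F) A n) (b : Fin n → ℤ) :
    (ρ.conj P).IsCrystallineOrdinaryOfExponents ℓ b ↔ ρ.IsCrystallineOrdinaryOfExponents ℓ b := by
  constructor
  · rintro ⟨g, ψ, hψ, h⟩
    refine ⟨g * P, ψ, hψ, ?_⟩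
    rwa [FramedRep.conj_conj] at h
  · rintro ⟨g, ψ, hψ, h⟩
    refine ⟨g * P⁻¹, ψ, hψ, ?_⟩
    rwa [FramedRep.conj_conj, inv_mul_cancel_right]

/-- **Ordinarity does not see the frame**: `P ρ P⁻¹` is ordinary iff `ρ` is. [folklore] -/
theorem FramedRep.isCrystallineOrdinary_conj_iff (P : GL (Fin n) A)
    (ρ : FramedRep (absoluteGaloisGroup F) A n) :
    (ρ.conj P).IsCrystallineOrdinary ℓ ↔ ρ.IsCrystallineOrdinary ℓ :=
  exists_congr fun b => and_congr Iff.rfl (FramedRep.isCrystallineOrdinaryOfExponents_conj_iff ℓ P ρ b)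

variable {ℓ} in
/-- **The determinant of an ordinary representation** is the product of its diagonal characters:
`det ρ(σ) = ∏_i ψ_i(σ) ε(σ)^{b_i}` (`det` is conjugation invariant, and the determinant of an upper
triangular matrix is the product of its diagonal, `FramedRep.IsUpperTriangular.det_eq_prod_diagEntry`).
[folklore] -/
theorem FramedRep.IsCrystallineOrdinaryOfExponents.exists_det_eq
    {ρ : FramedRep (absoluteGaloisGroup F) A n} {b : Fin n → ℤ}
    (h : ρ.IsCrystallineOrdinaryOfExponents ℓ b) :
    ∃ ψ : Fin n → FramedRep (absoluteGaloisGroup F) A 1, (∀ i, (ψ i).IsLocallyUnramified) ∧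
      ∀ σ, (ρ.det σ : A) = ∏ i, (ψ i).trace σ *
        ((Units.map (algebraMap ℤ_[ℓ] A).toMonoidHom (GaloisRep.cyclotomicCharacter F ℓ σ) ^ b i :
          Aˣ) : A) := by
  obtain ⟨g, ψ, hψ, htri, hdiag⟩ := h
  refine ⟨ψ, hψ, fun σ => ?_⟩
  have hdet : ρ.det σ = (ρ.conj g).det σ := by
    rw [FramedRep.det_apply, FramedRep.det_apply, FramedRep.conj_apply, map_mul, map_mul, map_inv,
      mul_inv_cancel_comm]
  rw [hdet, FramedRep.det_apply, Matrix.GeneralLinearGroup.val_det_apply,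
    htri.det_eq_prod_diagEntry σ]
  exact Finset.prod_congr rfl fun i _ => hdiag σ i

omit [Algebra ℤ_[ℓ] A] in
/-- **Non-vacuity: the cyclotomic character is ordinary with exponent `1`.**  The rank-one framed
cyclotomic character `Γ_F →ₜ* GL_1(ℤ_ℓ)` (`FramedGaloisRep.cyclotomic F ℓ`) is ordinary with
`g = 1`, `b = 1`, `ψ = 1`. [folklore] -/
theorem FramedRep.isCrystallineOrdinaryOfExponents_cyclotomic :
    FramedRep.IsCrystallineOrdinaryOfExponents ℓ (FramedGaloisRep.cyclotomic F ℓ) fun _ => 1 := by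
  refine ⟨1, fun _ => 1, fun i σ _ => rfl, ?_, fun σ i => ?_⟩
  · intro σ i j hij
    rw [Fin.eq_zero i, Fin.eq_zero j] at hij
    exact absurd hij (lt_irrefl _)
  · simp [FramedRep.trace, FramedGaloisRep.cyclotomic, Algebra.algebraMap_self]

omit [Algebra ℤ_[ℓ] A] in
/-- The cyclotomic character `Γ_F →ₜ* GL_1(ℤ_ℓ)` is (crystalline-)ordinary. [folklore] -/
theorem FramedRep.isCrystallineOrdinary_cyclotomic :
    FramedRep.IsCrystallineOrdinary ℓ (FramedGaloisRep.cyclotomic F ℓ) :=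
  (FramedRep.isCrystallineOrdinaryOfExponents_cyclotomic ℓ).isCrystallineOrdinary
    fun i j hij => absurd hij (by rw [Fin.eq_zero i, Fin.eq_zero j]; exact lt_irrefl _)

variable {ℓ} in
/-- **Rank two, comparison with Skinner–Wiles.**  A rank-two `ρ` that is ordinary with cyclotomic
exponents `(k - 1, 0)`, `k ≥ 1` — `ρ ≅ (ψ₀ ε^{k-1} ∗ ; 0 ψ₁)` with `ψ₀, ψ₁` unramified — is ordinary
of weight `k` with inertial exponent `m = 1` in the sense of `FramedGaloisRep.IsOrdinaryOfWeight`
(`OrdinaryGaloisRep.lean`: `θ₂ = 1` and `θ₁ = ε^{k-1}` on inertia, frame `Q = g⁻¹`). [folklore] -/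
theorem FramedRep.IsCrystallineOrdinaryOfExponents.isOrdinaryOfWeight
    {ρ : FramedGaloisRep F A 2} {k : ℕ} (hk : 1 ≤ k)
    (h : FramedRep.IsCrystallineOrdinaryOfExponents ℓ ρ ![((k : ℤ) - 1), 0]) :
    FramedGaloisRep.IsOrdinaryOfWeight ℓ ρ k 1 := by
  obtain ⟨g, ψ, hψ, htri, hdiag⟩ := h
  have hconj : ∀ σ, g⁻¹⁻¹ * ρ σ * g⁻¹ = ρ.conj g σ := fun σ => by rw [inv_inv, FramedRep.conj_apply]
  have htr : ∀ i, ∀ σ ∈ absInertia F, (ψ i).trace σ = 1 := fun i σ hσ => by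
    simp [FramedRep.trace, hψ i σ hσ]
  refine ⟨g⁻¹, fun σ => ⟨?_, fun hσ => ⟨?_, ?_⟩⟩⟩
  · rw [hconj]
    exact htri σ 1 0 Fin.zero_lt_one
  · have h1 := hdiag σ 1
    rw [FramedRep.diagEntry_apply, htr 1 σ hσ, one_mul] at h1
    rw [hconj, pow_one, h1]
    simp
  · have h0 := hdiag σ 0
    rw [FramedRep.diagEntry_apply, htr 0 σ hσ, one_mul] at h0
    rw [hconj, pow_one, mul_one, h0]
    have hk' : ((k : ℤ) - 1) = ((k - 1 : ℕ) : ℤ) := by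
      rw [Nat.cast_sub hk, Nat.cast_one]
    simp only [Matrix.cons_val_zero, hk', zpow_natCast, Units.val_pow_eq_pow_val, Units.coe_map,
      RingHom.toMonoidHom_eq_coe, MonoidHom.coe_coe]

end Local

/-! ### The global predicate at a finite place -/

section Global

variable {K : Type} [Field K] [NumberField K] (ℓ : ℕ) [Fact ℓ.Prime] {A : Type*} [CommRing A]
  [TopologicalSpace A] [IsTopologicalRing A] [Algebra ℤ_[ℓ] A] {n : ℕ}

/-- **`ρ : Γ_K →ₜ* GL_n(A)` is (crystalline-)ordinary with distinct cyclotomic exponents at the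
finite place `v`** of the number field `K` (intended: `v ∣ ℓ`): its restriction
`ρ|_{Γ_{K_v}} = ρ.toLocal v` to the decomposition group at `v` (`K_v = v.adicCompletion K`, a
non-archimedean local field by `AdicCompletionLocalField`) is `FramedRep.IsCrystallineOrdinary ℓ`:
conjugate to an upper triangular representation with diagonal `ψ_i · ε^{b_i}`, `ψ_i` unramified,
`b` strictly decreasing.  The notion `IsCrystallineOrdinaryAt` requested by route
`SiegelEisensteinFern` (its inline clause `ORD`; `isCrystallineOrdinaryAt_padicAlgCl_iff`).
Greenberg-ordinary for a full flag; implies semi-stable at `v` (Perrin-Riou), not crystalline.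
[cite: Greenberg1991, §2 (definition of an ordinary p-adic representation)] -/
def FramedGaloisRep.IsCrystallineOrdinaryAt (v : HeightOneSpectrum (𝓞 K))
    (ρ : FramedGaloisRep K A n) : Prop :=
  (ρ.toLocal v).IsCrystallineOrdinary ℓ

/-- Unfolding lemma for `FramedGaloisRep.IsCrystallineOrdinaryAt`, in the route's shape.
[folklore] -/
theorem FramedGaloisRep.isCrystallineOrdinaryAt_iff (v : HeightOneSpectrum (𝓞 K))
    (ρ : FramedGaloisRep K A n) :
    ρ.IsCrystallineOrdinaryAt ℓ v ↔
      ∃ (g : GL (Fin n) A) (b : Fin n → ℤ)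
        (ψ : Fin n → FramedRep (absoluteGaloisGroup (v.adicCompletion K)) A 1),
        StrictAnti b ∧ (∀ i, (ψ i).IsLocallyUnramified) ∧
          ∀ σ, (∀ i₁ i₂ : Fin n, i₂ < i₁ → ((ρ.toLocal v).conj g σ).val i₁ i₂ = 0) ∧
            ∀ i, ((ρ.toLocal v).conj g σ).val i i = (ψ i).trace σ *
              ((Units.map (algebraMap ℤ_[ℓ] A).toMonoidHom
                  (GaloisRep.cyclotomicCharacter (v.adicCompletion K) ℓ σ) ^ b i : Aˣ) : A) :=
  FramedRep.isCrystallineOrdinary_iff ℓ (ρ.toLocal v)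

/-- **Ordinarity at `v` does not see the frame**: `P ρ P⁻¹` is ordinary at `v` iff `ρ` is
(`FramedGaloisRep.toLocal_conj`, `FramedRep.isCrystallineOrdinary_conj_iff`). [folklore] -/
theorem FramedGaloisRep.isCrystallineOrdinaryAt_conj_iff (v : HeightOneSpectrum (𝓞 K))
    (P : GL (Fin n) A) (ρ : FramedGaloisRep K A n) :
    FramedGaloisRep.IsCrystallineOrdinaryAt ℓ v (FramedRep.conj P ρ) ↔
      ρ.IsCrystallineOrdinaryAt ℓ v := by
  rw [FramedGaloisRep.IsCrystallineOrdinaryAt, FramedGaloisRep.toLocal_conj]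
  exact FramedRep.isCrystallineOrdinary_conj_iff ℓ P (ρ.toLocal v)

/-- Over `ℚ̄_ℓ = PadicAlgCl ℓ` the `Aˣ`-valued power of the cyclotomic character is the field power
of its image under `ℚ_ℓ ↪ ℚ̄_ℓ` (the form used in the route statements). [folklore] -/
theorem units_map_algebraMap_padicAlgCl_zpow (u : ℤ_[ℓ]ˣ) (b : ℤ) :
    ((Units.map (algebraMap ℤ_[ℓ] (PadicAlgCl ℓ)).toMonoidHom u ^ b : (PadicAlgCl ℓ)ˣ) :
        PadicAlgCl ℓ) =
      (algebraMap ℚ_[ℓ] (PadicAlgCl ℓ) ((u : ℤ_[ℓ]) : ℚ_[ℓ])) ^ b := by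
  rw [Units.val_zpow_eq_zpow_val, Units.coe_map, RingHom.toMonoidHom_eq_coe, MonoidHom.coe_coe,
    IsScalarTower.algebraMap_apply ℤ_[ℓ] ℚ_[ℓ] (PadicAlgCl ℓ), PadicInt.algebraMap_apply]

/-- **The route's clause, verbatim.**  For `ρ : Γ_K →ₜ* GL_n(ℚ̄_ℓ)`,
`ρ.IsCrystallineOrdinaryAt ℓ v` is literally the inline clause `ORD` of the statements of route
`SiegelEisensteinFern` (`Summits/Langlands/Langlands/Theses/SiegelEisensteinFern.lean`):
`∃ g b ψ, StrictAnti b ∧ (∀ i, (ψ i).IsLocallyUnramified) ∧ ∀ σ, (entries of g ρ|_{K_v}(σ) g⁻¹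
below the diagonal vanish) ∧ (diagonal = ψ_i(σ) · (ε(σ) : ℚ̄_ℓ) ^ b_i)`. [folklore] -/
theorem FramedGaloisRep.isCrystallineOrdinaryAt_padicAlgCl_iff (v : HeightOneSpectrum (𝓞 K))
    (ρ : FramedGaloisRep K (PadicAlgCl ℓ) n) :
    ρ.IsCrystallineOrdinaryAt ℓ v ↔
      ∃ (g : Matrix.GeneralLinearGroup (Fin n) (PadicAlgCl ℓ)) (b : Fin n → ℤ)
        (ψ : Fin n → FramedRep (absoluteGaloisGroup (v.adicCompletion K)) (PadicAlgCl ℓ) 1),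
        StrictAnti b ∧ (∀ i, (ψ i).IsLocallyUnramified) ∧ ∀ σ,
          (∀ i₁ i₂ : Fin n, i₂ < i₁ → ((ρ.toLocal v).conj g σ).val i₁ i₂ = 0) ∧
          (∀ i, ((ρ.toLocal v).conj g σ).val i i = (ψ i).trace σ *
            (algebraMap ℚ_[ℓ] (PadicAlgCl ℓ)
              ((GaloisRep.cyclotomicCharacter (v.adicCompletion K) ℓ σ : ℤ_[ℓ]ˣ) : ℤ_[ℓ])) ^
                (b i)) := by
  simp only [FramedGaloisRep.isCrystallineOrdinaryAt_iff, units_map_algebraMap_padicAlgCl_zpow]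

end Global

end Literature.NumberTheory.GaloisRepresentations
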